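import Summits.Ventures.PercRepro.Night2ExcessMass

/-!
# PercRepro — the per-basis loss bound with spread basis members (night-2, gen 20)

`Night2ExcessLoss` majorises `1/(m + d)` on every face of a covering basis by one line `a − b m` valid on
`2 ≤ m ≤ n − ρ + 1`.  If every hyperplane-basis member misses at least `m₂` points (the `m₂`-spread of
`Night2LocalDGenS`), the faces that request anything have `m_w ≥ m₂`, so the chord of `1/(m + d)` over
`m₂ ≤ m ≤ n − ρ + 1` suffices, provided the line stays nonnegative on `2 ≤ m < m₂` (the faces that request nothing):

* `L1_le_sum_faces_ind`: `L1 Q ≤ Φ Σ_{w ∈ Q ∖ K} [Q ∖ w a thin cover preimage] / (m_w + d)`;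
* **`sum_faceLoss_le_excessBound_m2`**: the face losses of a covering basis sum to at most `excessBound` under
  the `m₂`-chord;
* **`localShadowHall_excess_of_sum'`**: the assembly of `Night2ExcessMass` with an abstract per-basis bound;
* **`localShadowHall_excess_of_sum_m2`**: (LI_G) from `genSum n ρ t c′ (E/ρ) ≥ 1` under `m₁` (non-basis members)
  and `m₂` (basis members).
-/

namespace PercRepro.Shadow

open Finset PerFlat ThmH

variable {α : Type*} [DecidableEq α] {M : Matroid α} [M.Finite]

open scoped Classical in
/-- The thin covering preimages of `Q` are exactly the faces `Q ∖ w` (`w ∈ Q ∖ K`) that are thin members with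
`w ∉ cl (Q ∖ w)`. -/
theorem thin_coverPreimages_eq_image {q : ℕ} {G : Finset α} (hG : G ∈ flatsQ M (q + 1))
    (hd : (gr M \ G).card ≤ q) {Q : Finset α} :
    (coverPreimages M (Uq M (q + 2) q) G Q).filter (fun B => B ∉ lay0 M q G) =
      Finset.image (fun w => Q.erase w)
        ((Q \ coloops M G).filter (fun w => Q.erase w ∈ thinMembers M q G ∧ w ∈ G \ clF M (Q.erase w))) := by
  ext B
  constructor
  · intro hB
    have hBi := thin_coverPreimages_subset_image_coloops hG hd Q hB
    rw [Finset.mem_image] at hBi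
    obtain ⟨w, hw, rfl⟩ := hBi
    have hwQK : w ∈ Q \ coloops M G := (mem_coloops.1 hw).1
    rw [Finset.mem_filter, mem_coverPreimages] at hB
    have hthin : Q.erase w ∈ thinMembers M q G := mem_thinMembers.2 ⟨hB.1.1, hB.2⟩
    obtain ⟨z, hz, hzQ⟩ := mem_coverSets.1 hB.1.2
    have hBU : Q.erase w ∈ Uq M (q + 2) q := (mem_membersIn.1 hB.1.1).1
    have hzB : z ∉ Q.erase w := notMem_of_notMem_clF hBU (Finset.mem_sdiff.1 hz).2
    have hzw : z = w := by
      have hzQ' : z ∈ Q := by rw [← hzQ]; exact Finset.mem_insert_self _ _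
      by_contra hne
      exact hzB (Finset.mem_erase.2 ⟨hne, hzQ'⟩)
    rw [Finset.mem_image]
    exact ⟨w, Finset.mem_filter.2 ⟨hwQK, hthin, hzw ▸ hz⟩, rfl⟩
  · intro hB
    rw [Finset.mem_image] at hB
    obtain ⟨w, hw, rfl⟩ := hB
    have hw' := (Finset.mem_filter.1 hw).2
    have hwQ : w ∈ Q := (Finset.mem_sdiff.1 (Finset.mem_filter.1 hw).1).1
    rw [Finset.mem_filter, mem_coverPreimages]
    refine ⟨⟨(mem_thinMembers.1 hw'.1).1, ?_⟩, (mem_thinMembers.1 hw'.1).2⟩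
    rw [mem_coverSets]
    exact ⟨w, hw'.2, Finset.insert_erase hwQ⟩

open scoped Classical in
/-- **`L1 Q ≤ Φ Σ_{w ∈ Q ∖ K} [Q ∖ w a thin cover preimage]/(m_w + d)`.** -/
theorem L1_le_sum_faces_ind {q d : ℕ} {G : Finset α} (hG : G ∈ flatsQ M (q + 1)) (hd : (gr M \ G).card = d)
    (hd1 : 1 ≤ d) (hdq : d ≤ q) {Q : Finset α} (hQ : Q ∈ shadowAt M (q + 2) q (Uq M (q + 2) q) G) :
    L1 M q G Q ≤ phiQ q * ∑ w ∈ Q \ coloops M G,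
      (if Q.erase w ∈ thinMembers M q G ∧ w ∈ G \ clF M (Q.erase w) then
        1 / (((G \ clF M (Q.erase w)).card : ℚ) + (d : ℚ)) else 0) := by
  have hd' : (gr M \ G).card ≤ q := by omega
  have hQG : Q ⊆ G := subset_G_of_mem_shadowAt hQ
  set W := (Q \ coloops M G).filter
    (fun w => Q.erase w ∈ thinMembers M q G ∧ w ∈ G \ clF M (Q.erase w)) with hW
  unfold L1
  rw [thin_coverPreimages_eq_image hG hd', Finset.sum_image (fun w hw w' hw' heq =>
    Finset.erase_injOn Q (Finset.mem_sdiff.1 (Finset.mem_filter.1 hw).1).1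
      (Finset.mem_sdiff.1 (Finset.mem_filter.1 hw').1).1 heq)]
  rw [Finset.sum_filter, Finset.mul_sum]
  apply Finset.sum_le_sum
  intro w _
  rw [mul_ite, mul_zero, mul_one_div]
  split_ifs with hcond
  · exact req_le_of_subset_G hG hd hd1 ((Finset.erase_subset w Q).trans hQG)
  · exact le_refl _

open scoped Classical in
/-- **THE PER-BASIS LOSS BOUND UNDER `m₂`-SPREAD**: if every hyperplane-basis member misses `≥ m₂` points, a line
`a − b m` (`b ≥ 0`) above `1/(m + d)` on `m₂ ≤ m ≤ n − ρ + 1` and nonnegative on `2 ≤ m ≤ n − ρ + 1` bounds the face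
losses of a covering basis by `excessBound q d ρ k n a b`. -/
theorem sum_faceLoss_le_excessBound_m2 {q d ρ m₂ : ℕ} {G : Finset α} (hG : G ∈ flatsQ M (q + 1))
    (hd : (gr M \ G).card = d) (hdq : d ≤ q) (hk : kColoops M G + ρ = q + 1) (hkd : kColoops M G + 1 ≤ d)
    (hs : ∀ e ∈ gr M, ∀ f ∈ gr M, e ≠ f → rkN M {e, f} = 2) (hl : ∀ e ∈ gr M, M.Indep {e})
    (hm₂ : ∀ B ∈ thinMembers M q G, (B \ coloops M G).card + 1 = ρ → m₂ ≤ (G \ clF M B).card)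
    {a b : ℚ} (hb : 0 ≤ b)
    (hchord : ∀ m : ℕ, m₂ ≤ m → m ≤ (G \ coloops M G).card - ρ + 1 →
      1 / ((m : ℚ) + (d : ℚ)) ≤ a - b * (m : ℚ))
    (hpos : ∀ m : ℕ, 2 ≤ m → m ≤ (G \ coloops M G).card - ρ + 1 → 0 ≤ a - b * (m : ℚ))
    (hE : 0 ≤ excessBound q d ρ (kColoops M G) (G \ coloops M G).card a b)
    {Q : Finset α} (hQ : Q ∈ shadowAt M (q + 2) q (Uq M (q + 2) q) G) (hQc : (Q \ coloops M G).card = ρ) :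
    ∑ w ∈ Q \ coloops M G, faceLoss M q G Q w ≤ excessBound q d ρ (kColoops M G) (G \ coloops M G).card a b := by
  have hd' : (gr M \ G).card ≤ q := by omega
  have hd1 : 1 ≤ d := by omega
  have hQG : Q ⊆ G := subset_G_of_mem_shadowAt hQ
  have hcap : 0 ≤ capS M q G Q := capS_nonneg' hG hd' Q
  have hcapDG : capDG q d (kColoops M G) ≤ capS M q G Q := by
    unfold capDG; exact capS_ge_one_sub_kColoops (q := q) hd hQG
  set n := (G \ coloops M G).card with hn
  have hface : ∀ w ∈ Q \ coloops M G,
      (if Q.erase w ∈ thinMembers M q G ∧ w ∈ G \ clF M (Q.erase w) then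
        1 / (((G \ clF M (Q.erase w)).card : ℚ) + (d : ℚ)) else 0) ≤
        a - b * ((G \ clF M (Q.erase w)).card : ℚ) := by
    intro w hw
    have hlo := two_le_card_face hk hQ hQc hw
    have hhi : (G \ clF M (Q.erase w)).card ≤ n - ρ + 1 := by
      have h1 := card_face_le hG hQ (w := w)
      have h2 := card_sdiff_add_eq_of_mem_shadowAt hQ hQc
      omega
    split_ifs with hcond
    · apply hchord _ _ hhi
      apply hm₂ _ hcond.1
      have hwQK : w ∈ Q \ coloops M G := hw
      have e : (Q.erase w) \ coloops M G = (Q \ coloops M G).erase w := by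
        ext x; simp only [Finset.mem_sdiff, Finset.mem_erase]; tauto
      rw [e, Finset.card_erase_of_mem hwQK, hQc]
      have : 1 ≤ ρ := by omega
      omega
    · exact hpos _ hlo hhi
  have hsumfaces := two_mul_card_le_sum_faces hG hk hs hl hQ hQc
  have hL1 : L1 M q G Q ≤ phiQ q * ((ρ : ℚ) * a - b * (2 * (n : ℚ) - (ρ : ℚ))) := by
    calc L1 M q G Q ≤ phiQ q * ∑ w ∈ Q \ coloops M G,
          (if Q.erase w ∈ thinMembers M q G ∧ w ∈ G \ clF M (Q.erase w) then
            1 / (((G \ clF M (Q.erase w)).card : ℚ) + (d : ℚ)) else 0) :=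
          L1_le_sum_faces_ind hG hd hd1 hdq hQ
      _ ≤ phiQ q * ∑ w ∈ Q \ coloops M G, (a - b * ((G \ clF M (Q.erase w)).card : ℚ)) :=
          mul_le_mul_of_nonneg_left (Finset.sum_le_sum hface) (phiQ_pos q).le
      _ = phiQ q * ((ρ : ℚ) * a - b * ∑ w ∈ Q \ coloops M G, ((G \ clF M (Q.erase w)).card : ℚ)) := by
          rw [Finset.sum_sub_distrib, Finset.sum_const, hQc, nsmul_eq_mul, Finset.mul_sum]
      _ ≤ phiQ q * ((ρ : ℚ) * a - b * (2 * (n : ℚ) - (ρ : ℚ))) := by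
          apply mul_le_mul_of_nonneg_left _ (phiQ_pos q).le
          have hcast : (2 * (n : ℚ) - (ρ : ℚ)) ≤ ∑ w ∈ Q \ coloops M G, ((G \ clF M (Q.erase w)).card : ℚ) := by
            have h := hsumfaces
            rw [← hn] at h
            have h' : ((2 * n : ℕ) : ℚ) ≤ ((ρ + ∑ w ∈ Q \ coloops M G, (G \ clF M (Q.erase w)).card : ℕ) : ℚ) := by
              exact_mod_cast h
            push_cast at h'
            linarith
          nlinarith [hcast, hb]
  calc ∑ w ∈ Q \ coloops M G, faceLoss M q G Q w ≤ L1 M q G Q * (1 - fS M q G Q) :=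
        sum_faceLoss_le_L1_mul hG hd' Q
    _ ≤ max 0 (L1 M q G Q - capS M q G Q) := L1_mul_one_sub_fS_le hcap
    _ ≤ excessBound q d ρ (kColoops M G) n a b := by
        apply max_le hE
        unfold excessBound
        linarith

open scoped Classical in
/-- **THE ASSEMBLY WITH AN ABSTRACT PER-BASIS BOUND**: in the partial-spread regime (`m₁` on the non-basis
members), if the face losses of every covering basis `K ∪ T` (`T` a `ρ`-subset of `S ∖ K`, `S ⊆ G`) sum to at
most `E > 0`, then (LI_G) holds as soon as `genSum n ρ (q − d + 1) c′ (E/ρ) ≥ 1` at `n = |G ∖ K|`. -/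
theorem localShadowHall_excess_of_sum' {q d ρ m₁ : ℕ} {G : Finset α} (hG : G ∈ flatsQ M (q + 1))
    (hd : (gr M \ G).card = d) (hdq : d ≤ q) (hk : kColoops M G + ρ = q + 1) (hρ : 3 ≤ ρ)
    (hs : ∀ e ∈ gr M, ∀ f ∈ gr M, e ≠ f → rkN M {e, f} = 2)
    (hl : ∀ e ∈ gr M, M.Indep {e}) (hc : 0 ≤ cPrimeDGP q d ρ (kColoops M G) m₁)
    (hm₁ : ∀ B ∈ thinMembers M q G, ρ ≤ (B \ coloops M G).card → m₁ ≤ (G \ clF M B).card)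
    {E : ℚ} (hE : 0 < E)
    (hTE : ∀ S : Finset α, S ⊆ G → ∀ T ∈ (S \ coloops M G).powersetCard ρ,
      ∑ w ∈ T, faceLoss M q G (coloops M G ∪ T) w ≤ E)
    (hsum : 1 ≤ DGenP.genSum (G.card - kColoops M G) ρ (q - d + 1) (cPrimeDGP q d ρ (kColoops M G) m₁)
      (E / (ρ : ℚ))) : LocalShadowHall M q G := by
  have hd' : (gr M \ G).card ≤ q := by omega
  have hKG : coloops M G ⊆ G := fun y hy => (mem_coloops.1 hy).1
  apply localShadowHall_of_lossFair hG hd'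
  intro B hB z hz
  by_cases hl0 : loss M q G B z = 0
  · rw [hl0]
    exact mul_nonneg (rhoL_nonneg hG hd' B z) (lossIncome_nonneg hG hd' B z)
  have hB' : B ∈ membersIn M (Uq M (q + 2) q) G := (mem_thinMembers.1 hB).1
  have hBU : B ∈ Uq M (q + 2) q := (mem_membersIn.1 hB').1
  have hzB : z ∉ B := notMem_of_notMem_clF hBU (Finset.mem_sdiff.1 hz).2
  have hK := coloops_subset_of_mem_thinMembers hG hd' hB
  have h2 : (B \ coloops M G).card + 1 = ρ := by
    by_contra hne
    have hge := card_sdiff_coloops_thin_ge hG hd' hk hB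
    exact hl0 (loss_eq_zero_of_card_ge_dgenP hG hd hdq hk hc hs hl hm₁ hB (by omega) hz)
  set n := G.card - kColoops M G with hn
  have hr : (G \ insert z B).card = n - ρ := card_sdiff_insert_eq_dqm1 hG hd' hB h2 hz
  have hr1 : 1 ≤ n - ρ := by rw [← hr]; exact one_le_card_sdiff_insert hG hd' hB hz
  have hBcard : B.card = kColoops M G + (B \ coloops M G).card := by
    rw [kColoops_eq_card_coloops, ← Finset.card_union_of_disjoint Finset.disjoint_sdiff,
      Finset.union_sdiff_of_subset hK]
  have hb' : (insert z B).card = q + 1 := by rw [Finset.card_insert_of_notMem hzB, hBcard]; omega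
  have hT : (tgtSets M q G B z).card = 2 ^ (n - ρ) - 1 := by rw [card_tgtSets hG hB' hz, hr]
  have hTpos : (0 : ℚ) < ((2 ^ (n - ρ) - 1 : ℕ) : ℚ) := by
    have : 2 ≤ 2 ^ (n - ρ) := by
      calc 2 = 2 ^ 1 := by norm_num
        _ ≤ 2 ^ (n - ρ) := Nat.pow_le_pow_right (by norm_num) hr1
    exact_mod_cast (by omega : 0 < 2 ^ (n - ρ) - 1)
  have hGcard : G.card = n + kColoops M G := by
    have : kColoops M G ≤ G.card := by
      rw [kColoops_eq_card_coloops]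
      exact Finset.card_le_card hKG
    omega
  set u : ℕ → ℚ := fun s => ((ρ : ℚ) * ((s - kColoops M G).choose ρ : ℚ)) *
    ((E / (ρ : ℚ)) / ((2 ^ (n - ρ) - 1 : ℕ) : ℚ)) with hu_def
  set v : ℕ → ℚ := fun s => if s + (q - d + 1) ≤ G.card then cPrimeDGP q d ρ (kColoops M G) m₁ else 1 with hv_def
  have hKS : ∀ S ∈ tgtSets M q G B z, coloops M G ⊆ S :=
    fun S hS => coloops_subset_of_mem_shadowAt (mem_tgtSets.1 hS).1
  have hSK : ∀ S ∈ tgtSets M q G B z, (S \ coloops M G).card = S.card - kColoops M G := by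
    intro S hS
    rw [Finset.card_sdiff_of_subset (hKS S hS), kColoops_eq_card_coloops]
  have hρ1 : ∀ S ∈ tgtSets M q G B z, ρ + 1 ≤ (S \ coloops M G).card := by
    intro S hS
    obtain ⟨-, hBS, hcard⟩ := mem_tgtSets.1 hS
    have hBS' : B ⊆ S := (Finset.subset_insert z B).trans hBS
    have hsub : (S \ B) ∪ (B \ coloops M G) ⊆ S \ coloops M G := by
      intro x hx
      rw [Finset.mem_union, Finset.mem_sdiff, Finset.mem_sdiff] at hx
      rw [Finset.mem_sdiff]
      rcases hx with ⟨hxS, hxB⟩ | ⟨hxB, hxK⟩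
      · exact ⟨hxS, fun h => hxB (hK h)⟩
      · exact ⟨hBS' hxB, hxK⟩
    have hdisj : Disjoint (S \ B) (B \ coloops M G) := by
      rw [Finset.disjoint_left]; intro x hx hx'
      exact (Finset.mem_sdiff.1 hx).2 (Finset.mem_sdiff.1 hx').1
    have := Finset.card_le_card hsub
    rw [Finset.card_union_of_disjoint hdisj] at this
    omega
  have hρ0 : (0 : ℚ) < (ρ : ℚ) := by exact_mod_cast (by omega : 0 < ρ)
  have hu : ∀ S ∈ tgtSets M q G B z, pi2Mass M q G S ≤ u S.card := by
    intro S hS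
    have hSG : S ⊆ G := subset_G_of_mem_shadowAt (mem_tgtSets.1 hS).1
    have hmass := pi2Mass_le_excess hG hd hdq hk hc hs hl hm₁ S (hTE S hSG)
    rw [hSK S hS] at hmass
    simp only [hu_def]
    calc pi2Mass M q G S ≤ ((S.card - kColoops M G).choose ρ : ℚ) *
          (E / ((2 ^ (n - ρ) - 1 : ℕ) : ℚ)) := hmass
      _ = ((ρ : ℚ) * ((S.card - kColoops M G).choose ρ : ℚ)) *
          ((E / (ρ : ℚ)) / ((2 ^ (n - ρ) - 1 : ℕ) : ℚ)) := by
          field_simp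
  have hv : ∀ S ∈ tgtSets M q G B z, v S.card ≤ cap2 M q G S := by
    intro S hS
    have hS' := (mem_tgtSets.1 hS).1
    have hSG : S ⊆ G := subset_G_of_mem_shadowAt hS'
    simp only [hv_def]
    split_ifs with hle
    · exact cap2_ge_cPrimeDGP hG hd hdq hk hs hl hm₁ hS' (hρ1 S hS)
    · push Not at hle
      have h1 : (G \ S).card ≤ q - d := by
        rw [Finset.card_sdiff_of_subset hSG]; omega
      exact (cap2_eq_one_of_card_le hG (by rw [hd]; omega)).ge
  have hv0 : ∀ S ∈ tgtSets M q G B z, 0 ≤ v S.card := by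
    intro S _
    simp only [hv_def]
    split_ifs
    · exact hc
    · exact zero_le_one
  have hinc := lossIncome_ge_of_bounds hG hd' hB hz hl0 u v hu hv hv0
  rw [hr, hb'] at hinc
  have hsum' : ∑ j ∈ Finset.Icc 1 (n - ρ), ((n - ρ).choose j : ℚ) * (v (q + 1 + j) / u (q + 1 + j)) =
      ((2 ^ (n - ρ) - 1 : ℕ) : ℚ) * DGenP.genSum n ρ (q - d + 1) (cPrimeDGP q d ρ (kColoops M G) m₁)
        (E / (ρ : ℚ)) := by
    unfold DGenP.genSum
    rw [Finset.mul_sum]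
    apply Finset.sum_congr rfl
    intro j hj
    rw [Finset.mem_Icc] at hj
    have hv' : v (q + 1 + j) = DGenP.cjG n ρ (q - d + 1) j (cPrimeDGP q d ρ (kColoops M G) m₁) := by
      simp only [hv_def, DGenP.cjG]
      have hiff : q + 1 + j + (q - d + 1) ≤ G.card ↔ j + ρ + (q - d + 1) ≤ n := by omega
      by_cases hcj : j + ρ + (q - d + 1) ≤ n
      · rw [if_pos (hiff.2 hcj), if_pos hcj]
      · rw [if_neg (fun h => hcj (hiff.1 h)), if_neg hcj]
    have hu' : u (q + 1 + j) = ((ρ : ℚ) * ((j + ρ).choose ρ : ℚ)) *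
        ((E / (ρ : ℚ)) / ((2 ^ (n - ρ) - 1 : ℕ) : ℚ)) := by
      simp only [hu_def]
      rw [show q + 1 + j - kColoops M G = j + ρ by omega]
    rw [hv', hu']
    have hjρ : (0 : ℚ) < ((j + ρ).choose ρ : ℚ) := by exact_mod_cast Nat.choose_pos (by omega)
    field_simp
  rw [hsum'] at hinc
  unfold rhoL
  rw [hT]
  have hl' : 0 < loss M q G B z := lt_of_le_of_ne (loss_nonneg' hG hd' B z) (Ne.symm hl0)
  calc loss M q G B z = loss M q G B z / ((2 ^ (n - ρ) - 1 : ℕ) : ℚ) * ((2 ^ (n - ρ) - 1 : ℕ) : ℚ) := by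
        field_simp
    _ ≤ loss M q G B z / ((2 ^ (n - ρ) - 1 : ℕ) : ℚ) *
          (((2 ^ (n - ρ) - 1 : ℕ) : ℚ) * DGenP.genSum n ρ (q - d + 1) (cPrimeDGP q d ρ (kColoops M G) m₁)
            (E / (ρ : ℚ))) := by
        apply mul_le_mul_of_nonneg_left _ (div_nonneg hl'.le hTpos.le)
        nlinarith [hsum, hTpos]
    _ ≤ loss M q G B z / ((2 ^ (n - ρ) - 1 : ℕ) : ℚ) * lossIncome M q G B z :=
        mul_le_mul_of_nonneg_left hinc (div_nonneg hl'.le hTpos.le)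

open scoped Classical in
/-- **THE PER-BASIS EXCESS REGIME WITH SPREAD BASIS MEMBERS MODULO ITS TARGET SUM**: `m₁` on the non-basis
members, `m₂` on the basis members, the `m₂`-chord `a − b m` (nonnegative on `2 ≤ m ≤ n − ρ + 1`). -/
theorem localShadowHall_excess_of_sum_m2 {q d ρ m₁ m₂ : ℕ} {G : Finset α} (hG : G ∈ flatsQ M (q + 1))
    (hd : (gr M \ G).card = d) (hdq : d ≤ q) (hk : kColoops M G + ρ = q + 1) (hρ : 3 ≤ ρ)
    (hkd : kColoops M G + 1 ≤ d) (hs : ∀ e ∈ gr M, ∀ f ∈ gr M, e ≠ f → rkN M {e, f} = 2)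
    (hl : ∀ e ∈ gr M, M.Indep {e}) (hc : 0 ≤ cPrimeDGP q d ρ (kColoops M G) m₁)
    (hm₁ : ∀ B ∈ thinMembers M q G, ρ ≤ (B \ coloops M G).card → m₁ ≤ (G \ clF M B).card)
    (hm₂ : ∀ B ∈ thinMembers M q G, (B \ coloops M G).card + 1 = ρ → m₂ ≤ (G \ clF M B).card)
    {a b : ℚ} (hb : 0 ≤ b)
    (hchord : ∀ m : ℕ, m₂ ≤ m → m ≤ (G.card - kColoops M G) - ρ + 1 →
      1 / ((m : ℚ) + (d : ℚ)) ≤ a - b * (m : ℚ))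
    (hpos : ∀ m : ℕ, 2 ≤ m → m ≤ (G.card - kColoops M G) - ρ + 1 → 0 ≤ a - b * (m : ℚ))
    (hE : 0 < excessBound q d ρ (kColoops M G) (G.card - kColoops M G) a b)
    (hsum : 1 ≤ DGenP.genSum (G.card - kColoops M G) ρ (q - d + 1) (cPrimeDGP q d ρ (kColoops M G) m₁)
      (excessBound q d ρ (kColoops M G) (G.card - kColoops M G) a b / (ρ : ℚ))) : LocalShadowHall M q G := by
  have hKG : coloops M G ⊆ G := fun y hy => (mem_coloops.1 hy).1
  have hnK : (G \ coloops M G).card = G.card - kColoops M G := by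
    rw [Finset.card_sdiff_of_subset hKG, kColoops_eq_card_coloops]
  apply localShadowHall_excess_of_sum' hG hd hdq hk hρ hs hl hc hm₁ hE _ hsum
  intro S _ T hT
  rw [Finset.mem_powersetCard] at hT
  obtain ⟨hTS, hTc⟩ := hT
  have hTK : Disjoint (coloops M G) T := by
    rw [Finset.disjoint_left]
    intro x hx hxT
    exact (Finset.mem_sdiff.1 (hTS hxT)).2 hx
  have hQT : (coloops M G ∪ T) \ coloops M G = T := Finset.union_sdiff_cancel_left hTK
  have hQc : ((coloops M G ∪ T) \ coloops M G).card = ρ := by rw [hQT, hTc]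
  have hchord' : ∀ m : ℕ, m₂ ≤ m → m ≤ (G \ coloops M G).card - ρ + 1 →
      1 / ((m : ℚ) + (d : ℚ)) ≤ a - b * (m : ℚ) := by
    intro m hm hm'; rw [hnK] at hm'; exact hchord m hm hm'
  have hpos' : ∀ m : ℕ, 2 ≤ m → m ≤ (G \ coloops M G).card - ρ + 1 → 0 ≤ a - b * (m : ℚ) := by
    intro m hm hm'; rw [hnK] at hm'; exact hpos m hm hm'
  have hE' : 0 ≤ excessBound q d ρ (kColoops M G) (G \ coloops M G).card a b := by
    rw [hnK]; exact hE.le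
  by_cases hQ : coloops M G ∪ T ∈ shadowAt M (q + 2) q (Uq M (q + 2) q) G
  · have := sum_faceLoss_le_excessBound_m2 hG hd hdq hk hkd hs hl hm₂ hb hchord' hpos' hE' hQ hQc
    rw [hQT, hnK] at this
    exact this
  · have hzero : ∀ w ∈ T, faceLoss M q G (coloops M G ∪ T) w = 0 := by
      intro w hw
      unfold faceLoss
      rw [if_neg]
      rintro ⟨hthin, hwc⟩
      apply hQ
      have := insert_mem_shadowAt_thin hG hthin hwc
      rwa [Finset.insert_erase (Finset.mem_union_right _ hw)] at this
    rw [Finset.sum_eq_zero hzero]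
    exact hE.le

end PercRepro.Shadow
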